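import Literature.MathematicalPhysics.QuantumFieldTheory.Balaban1983to89.BlockAveragingZd
import Literature.MathematicalPhysics.QuantumFieldTheory.Balaban1983to89.B12ContourAverage253

/-!
# `Balaban1983to89.BlockAveragingZdCovariance` — [Balaban1987RG1] (0.4)∕(0.6) p. 253 with [Balaban1985Averaging] (8) p. 18, (11) p. 19,
# (45) p. 24: GAUGE COVARIANCE of the symmetric block averaging of record transcribed to `ℤᵈ` (`BlockAveragingZd`): `\overline{V^u}_c =
# u(c₋) V̄_c u(c₊)⁻¹` and `\overline{U^u}^{\,j} = (Ū^{j})^{u_j}` for the unguarded (0.4) and EVERY invertible gauge function, and for the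
# guarded (0.4) of record under `U1 𝔸`-valued gauge functions (the guard reads norms)

statement-level skeleton of published theorems with citation tags; proofs where landed; nothing here is a claim about the Yang–Mills mass gap

CITATION HEADER (lean-in-tree rule).  Cell `pub-ymgap`, seat `pub-ymgap-dag-n05-e` g35; task R0 of the «N05-REC» road (director-ym №251 (4));
sibling of `BlockAveragingZd` (module R0a), split off for the 400-line rule.  PROOF lane (theorems only): `--kind proof --supports
stmt-QuantumFields-20541`.  Sources READ: [I] = [Balaban1987RG1] (0.4)–(0.7) p. 253 (`paper:balaban1987-cmp109-rg-i-small-field`, p0004–p0005); [3] = [Balaban1985Averaging]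
(8) p. 18, (11) p. 19, (45) p. 24 (`paper:balaban1985-cmp98-averaging`).  The engine's twins of these facts: `B7Prop1Explicit.bavg_gaugeAct`,
`B7Prop6Flat.bavg_gaugeAct_units` ∕ `avgIter_gaugeAct_units` (proofs copied shape for shape); NODE 00's: `BlockAveraging.avgFun_covariant`.
WHAT IS PROVED (sorry-free).  §1 `smallZ_gaugeAct_iff` (the guard is gauge invariant; conjugation by `U1 𝔸` preserves `‖· − 1‖` —
`B12ContourAverage253.norm_units_conj_sub_one_eq`, REUSED BY NAME).  §2 `XZ_gaugeAct_units`, `bavgZ_gaugeAct_units`, `avgIterZ_gaugeAct_units` — ANY invertible gauge function (the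
series `log` is conjugation-equivariant with no condition, `B7Prop6Flat.mlog_conj`).  §3 `bavgZG_gaugeAct`, `uLev_mem_U1`, `avgIterZG_gaugeAct`
— `U1 𝔸`-valued gauge functions.
HONEST SCOPE.  Kernel bookkeeping; NO inequality of [3]∕[6]∕[I]; `HThm4Rec` UNDISCHARGED; N05-REC R1–R7 NOT commissioned; N05 ∕ N07 NOT
discharged; counts unmoved; one finite 𝕋⁴ programme at fixed ε — nothing continuum ∕ ℝ⁴ ∕ OS ∕ mass gap ∕ Clay.  No `def`, no `instance`, no `sorry`.
-/

set_option autoImplicit false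

noncomputable section

open scoped BigOperators

namespace Literature.MathematicalPhysics.QuantumFieldTheory.Balaban1983to89.BlockAveragingZdCovariance

open BlockAveragingZd
open B7Prop1Explicit (Letter e disp_seg hol hol_gaugeAct gaugeAct seg expUnit val_expUnit U1)
open B12ContourAverage253 (norm_units_conj_sub_one_eq)
open B7Prop2Explicit (rescale rescale_apply)
open B7Prop1Explicit renaming Site → SiteZ
open B7AvgGaugeCovariance (uLev uLev_smul uLev_smul_add)
open B7Prop6Flat (mlog_conj)

variable {d : ℕ}

/-! ## §1 The guard is gauge invariant -/

section Guard

variable {𝔸 : Type*} [NormedRing 𝔸] [NormOneClass 𝔸] (L : ℕ)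

/-- **The guard is gauge INVARIANT** under gauge functions valued in `U1 𝔸` (NODE 00's `small_gaugeAct_iff`). [cite: Balaban1987RG1, (0.4) p.253; Balaban1985Averaging, (8) p.18] -/
theorem smallZ_gaugeAct_iff {δ : ℝ} {u : SiteZ d → 𝔸ˣ} (hu : ∀ x, u x ∈ U1 𝔸) (V : SiteZ d → Fin d → 𝔸ˣ)
    (q : SiteZ d) (κ : Fin d) : SmallZ L δ (gaugeAct u V) q κ ↔ SmallZ L δ V q κ := by
  unfold SmallZ
  refine forall_congr' fun i => ?_
  rw [WZ_gaugeAct, Units.val_mul, Units.val_mul, norm_units_conj_sub_one_eq (hu q)]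

end Guard

/-! ## §2 Covariance of the unguarded (0.4), any invertible gauge function -/

section Units

variable {𝔸 : Type*} [NormedRing 𝔸] [NormedAlgebra ℂ 𝔸] (L : ℕ)

/-- **[3] (45) for the exponent, for EVERY invertible gauge function**: `XZ[V^u] = u(q) XZ[V] u(q)⁻¹` (termwise: the series `log`
is conjugation-equivariant with no condition, `B7Prop6Flat.mlog_conj`). [cite: Balaban1985Averaging, (45) p.24; Balaban1987RG1, (0.6) p.253] -/
theorem XZ_gaugeAct_units (u : SiteZ d → 𝔸ˣ) (V : SiteZ d → Fin d → 𝔸ˣ) (q : SiteZ d) (κ : Fin d) :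
    XZ L (gaugeAct u V) q κ = (u q : 𝔸) * XZ L V q κ * ((u q)⁻¹ : 𝔸ˣ) := by
  unfold XZ
  rw [Finset.mul_sum, Finset.sum_mul]
  refine Finset.sum_congr rfl fun i _ => ?_
  rw [WZ_gaugeAct, Units.val_mul, Units.val_mul, mlog_conj (u q), mul_smul_comm, smul_mul_assoc]

variable [CompleteSpace 𝔸]

/-- **[3] (45) = (11) for the unguarded (0.4), for EVERY invertible gauge function**: `\overline{V^u}_c = u(c₋) V̄_c u(c₊)⁻¹`,
`c₋ = q` the block centre, `c₊ = q + Le_κ`. [cite: Balaban1985Averaging, (45) p.24, (11) p.19; Balaban1987RG1, (0.6) p.253] -/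
theorem bavgZ_gaugeAct_units (u : SiteZ d → 𝔸ˣ) (V : SiteZ d → Fin d → 𝔸ˣ) (q : SiteZ d) (κ : Fin d) :
    bavgZ L (gaugeAct u V) q κ = u q * bavgZ L V q κ * (u (q + (L : ℤ) • e κ))⁻¹ := by
  letI : NormedAlgebra ℚ 𝔸 := NormedAlgebra.restrictScalars ℚ ℂ 𝔸
  apply Units.ext
  simp only [bavgZ, Units.val_mul, val_expUnit]
  rw [XZ_gaugeAct_units L u V q κ, hol_gaugeAct, disp_seg, NormedSpace.exp_units_conj, Units.val_mul, Units.val_mul]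
  simp only [mul_assoc, Units.inv_mul_cancel_left]

/-- **(11) for the unguarded `k`-fold (0.4)**: `\overline{U^u}^{\,j} = (Ū^{j})^{u_j}`, `u_j(z) = u(L^j z)` (`B7AvgGaugeCovariance.uLev`), for every
invertible gauge function. [cite: Balaban1985Averaging, (11) p.19, (43) p.24; Balaban1987RG1, (0.6) p.253] -/
theorem avgIterZ_gaugeAct_units (u : SiteZ d → 𝔸ˣ) (V : SiteZ d → Fin d → 𝔸ˣ) :
    ∀ j : ℕ, avgIterZ L (gaugeAct u V) j = gaugeAct (uLev L u j) (avgIterZ L V j)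
  | 0 => by simp
  | j + 1 => by
    funext z κ
    rw [avgIterZ_succ, avgIterZ_succ, rescale_apply, avgIterZ_gaugeAct_units u V j, bavgZ_gaugeAct_units]
    simp only [gaugeAct, rescale_apply, uLev_smul, uLev_smul_add]

end Units

/-! ## §3 Covariance of the guarded (0.4) of record, `U1 𝔸`-valued gauge functions -/

section Guarded

variable {𝔸 : Type*} [NormedRing 𝔸] [NormOneClass 𝔸] [NormedAlgebra ℂ 𝔸] [CompleteSpace 𝔸] (L : ℕ)

/-- **(11) for the GUARDED (0.4)** under gauge functions valued in `U1 𝔸` (the guard is then invariant): `\overline{V^u}_c =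
u(c₋) V̄_c u(c₊)⁻¹` (NODE 00's `avgFun_covariant`). [cite: Balaban1985Averaging, (11) p.19; Balaban1987RG1, (0.6) p.253] -/
theorem bavgZG_gaugeAct {δ : ℝ} {u : SiteZ d → 𝔸ˣ} (hu : ∀ x, u x ∈ U1 𝔸) (V : SiteZ d → Fin d → 𝔸ˣ) (q : SiteZ d) (κ : Fin d) :
    bavgZG L δ (gaugeAct u V) q κ = u q * bavgZG L δ V q κ * (u (q + (L : ℤ) • e κ))⁻¹ := by
  by_cases h : SmallZ L δ V q κ
  · rw [bavgZG_eq_bavgZ_of_small L ((smallZ_gaugeAct_iff L hu V q κ).mpr h), bavgZG_eq_bavgZ_of_small L h,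
      bavgZ_gaugeAct_units]
  · rw [bavgZG_eq_of_not_small L (fun h' => h ((smallZ_gaugeAct_iff L hu V q κ).mp h')), bavgZG_eq_of_not_small L h,
      hol_gaugeAct, disp_seg]

omit [NormedAlgebra ℂ 𝔸] [CompleteSpace 𝔸] in
/-- `u_j = uLev L u j` ([3] (11)'s level-`j` gauge function) is `U1 𝔸`-valued when `u` is. [cite: Balaban1985Averaging, (11) p.19] -/
theorem uLev_mem_U1 {u : SiteZ d → 𝔸ˣ} (hu : ∀ x, u x ∈ U1 𝔸) (j : ℕ) (z : SiteZ d) : uLev L u j z ∈ U1 𝔸 := hu _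

/-- **(11) for the GUARDED `k`-fold (0.4)** under `U1 𝔸`-valued gauge functions: `\overline{U^u}^{\,j} = (Ū^{j})^{u_j}` (NODE 00's
`Averaging.iter` covariance). [cite: Balaban1985Averaging, (11) p.19, (43) p.24; Balaban1987RG1, (0.6) p.253] -/
theorem avgIterZG_gaugeAct {δ : ℝ} {u : SiteZ d → 𝔸ˣ} (hu : ∀ x, u x ∈ U1 𝔸) (V : SiteZ d → Fin d → 𝔸ˣ) :
    ∀ j : ℕ, avgIterZG L δ (gaugeAct u V) j = gaugeAct (uLev L u j) (avgIterZG L δ V j)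
  | 0 => by simp
  | j + 1 => by
    funext z κ
    rw [avgIterZG_succ, avgIterZG_succ, rescale_apply, avgIterZG_gaugeAct hu V j,
      bavgZG_gaugeAct L (uLev_mem_U1 L hu j)]
    simp only [gaugeAct, rescale_apply, uLev_smul, uLev_smul_add]

end Guarded

end Literature.MathematicalPhysics.QuantumFieldTheory.Balaban1983to89.BlockAveragingZdCovariance
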